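import Literature.NumberTheory.Automorphic.HeckePolynomialPoint
import Literature.NumberTheory.Automorphic.LevelActionTrivialOnLevel
import Literature.NumberTheory.Automorphic.HidaTowerLevels
import Literature.NumberTheory.Automorphic.HidaLemmaGL2
import HarnessLib

/-!
# The factors of the Hida tower as trivial-coefficient level-action cohomology

Topic `NumberTheory/Automorphic`; namespaces `Literature.NumberTheory.Automorphic.ArithmeticQuotient`
(generic) and `Literature.NumberTheory.Automorphic.BigHeckeGLn.TameLevel`; definitions with bodies
(`abbrev`s of the level-action objects, an `eqToIso`, the bridge isomorphism) and theorems; no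
named fact, no `sorry`.

The statement `hidaControl_dominantOrdinaryPoint` is about the factors
`H^i(X_{U(r)}, ℤ/p^s)^{ord} = TameLevel.ordinaryPart ℤ (i, r, s)` of the arithmetic-quotient model at
the Hida levels `U(r) = hidaLevel r`, while the finite-level control machinery
(`LevelControlFiniteLevel`, `LevelActionHidaLemma`, …) lives in the level-action model
`LevelAction.cohomology ι Δ τ U i` at the two-parameter levels `U(b, c) = TameLevel.level b c`.  For
TRIVIAL coefficients the two agree (`LevelActionTrivialOnLevel.cohomologyIso`); this file packages the
identification ON THE NOSE, with all Hecke operators: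

* `ArithmeticQuotient.levelEqIso` — `H^i(X_L, M) ≅ H^i(X_{L'}, M)` for EQUAL levels `L = L'`
  (`eqToIso`), compatible with every `T_g` (`levelEqIso_hom_comp_heckeEnd`);
* `TameLevel.laCohomology k 𝒰 b c s i = H^i(U(b,c), 1; k/p^s)` (level-action model, `Δ = ⊤`,
  `τ = 1`), `laHecke` its Hecke operators, `laOrd` its `U_p`-ordinary part
  `⋂_{v ∣ p} ⋂ₘ range U_{v,1}^m`;
* **`TameLevel.towerBridge k 𝒰 r s i : H^i(X_{U(r)}, k/p^s) ≅ H^i(U(r, max r 1), 1; k/p^s)`**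
  (`hidaLevel_eq_level` + `cohomologyIso`), with `towerBridge_hom_comp_hidaFamily`:
  `Φ ∘ [U(r) g U(r)] = [U g U]^{LA} ∘ Φ` for EVERY `g`, and
  **`map_ordinaryPart_towerBridge`**: `Φ(H^{ord}) = laOrd` (`ordinaryPart_eq_iInf_range`).

[cite: Hida1994AIF, §1 (the models), §3] [cite: KhareThorne2017, §6.3–6.5]

## References

* H. Hida, Ann. Inst. Fourier 44 (1994), §1, §3. [Hida1994AIF]
* C. Khare, J. A. Thorne, Amer. J. Math. 139 (2017), §6.3–6.5. [KhareThorne2017]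
-/

noncomputable section

open CategoryTheory IsDedekindDomain
open scoped NumberField

namespace Literature.NumberTheory.Automorphic

/-! ### Generic: inverting a compatibility along an isomorphism -/

/-- If `e.hom ∘ A = B ∘ e.hom` for an isomorphism `e` of modules then `e.inv ∘ B = A ∘ e.inv`.
[folklore] -/
theorem ModuleCat.inv_hom_comp_eq_of_hom_comp {k : Type} [CommRing k] {X Y : ModuleCat k} (e : X ≅ Y)
    {A : Module.End k X} {B : Module.End k Y} (h : e.hom.hom ∘ₗ A = B ∘ₗ e.hom.hom) :
    e.inv.hom ∘ₗ B = A ∘ₗ e.inv.hom := by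
  have hih : e.hom.hom ∘ₗ e.inv.hom = LinearMap.id := by
    rw [← ModuleCat.hom_comp, e.inv_hom_id, ModuleCat.hom_id]
  have hhi : e.inv.hom ∘ₗ e.hom.hom = LinearMap.id := by
    rw [← ModuleCat.hom_comp, e.hom_inv_id, ModuleCat.hom_id]
  calc e.inv.hom ∘ₗ B = e.inv.hom ∘ₗ B ∘ₗ (e.hom.hom ∘ₗ e.inv.hom) := by rw [hih, LinearMap.comp_id]
    _ = e.inv.hom ∘ₗ (e.hom.hom ∘ₗ A) ∘ₗ e.inv.hom := by rw [← LinearMap.comp_assoc e.inv.hom e.hom.hom B, ← h]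
    _ = A ∘ₗ e.inv.hom := by rw [← LinearMap.comp_assoc, ← LinearMap.comp_assoc, hhi, LinearMap.id_comp]

/-! ### Generic: equal levels -/

namespace ArithmeticQuotient

variable (k : Type) [CommRing k] {Γ 𝒢 : Type} [Group Γ] [Group 𝒢] (ι : Γ →* 𝒢)
  (M : Type) [AddCommGroup M] [Module k M]

/-- `H^i(X_L, M) ≅ H^i(X_{L'}, M)` for equal levels `L = L'`. [folklore] -/
def levelEqIso {L L' : Subgroup 𝒢} (h : L = L') (i : ℕ) :
    cohomology k ι L M i ≅ cohomology k ι L' M i :=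
  eqToIso (by subst h; rfl)

/-- `levelEqIso` is compatible with every Hecke operator `T_g`. [folklore] -/
theorem levelEqIso_hom_comp_heckeEnd {L L' : Subgroup 𝒢} (h : L = L') (g : 𝒢) (i : ℕ) :
    (levelEqIso k ι M h i).hom.hom ∘ₗ heckeEnd k L g M ι i =
      heckeEnd k L' g M ι i ∘ₗ (levelEqIso k ι M h i).hom.hom := by
  subst h
  simp [levelEqIso]

/-- Pointwise form. [folklore] -/
theorem levelEqIso_hom_heckeEnd_apply {L L' : Subgroup 𝒢} (h : L = L') (g : 𝒢) (i : ℕ)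
    (x : cohomology k ι L M i) :
    (levelEqIso k ι M h i).hom (heckeEnd k L g M ι i x) =
      heckeEnd k L' g M ι i ((levelEqIso k ι M h i).hom x) := by
  subst h
  simp [levelEqIso]

end ArithmeticQuotient

/-! ### The Hida tower factors in the level-action model -/

namespace BigHeckeGLn

namespace TameLevel

open LevelAction

variable (k : Type) [CommRing k] {K : Type} [Field K] [NumberField K] {p : ℕ} [Fact p.Prime]
  (𝒰 : TameLevel 2 K p)

/-- **`H^i(U(b,c), 1; k/p^s)`**: the trivial-coefficient level-action cohomology at the Hida level
`U(b, c)`. [cite: Hida1994AIF, §1] -/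
abbrev laCohomology (b c s i : ℕ) : ModuleCat k :=
  LevelAction.cohomology (globalEmbedding 2 K) (⊤ : Submonoid (FiniteAdelicGL 2 K)) (1 : (⊤ : Submonoid (FiniteAdelicGL 2 K)) →* Module.End k (modPow k (p : k) s))
    (𝒰.level b c) i

/-- Its Hecke operator `[U g U]` (any `g`). [folklore] -/
abbrev laHecke (b c s : ℕ) (g : FiniteAdelicGL 2 K) (i : ℕ) : Module.End k (𝒰.laCohomology k b c s i) :=
  heckeCohomology (globalEmbedding 2 K) (⊤ : Submonoid (FiniteAdelicGL 2 K)) (1 : (⊤ : Submonoid (FiniteAdelicGL 2 K)) →* Module.End k (modPow k (p : k) s))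
    (𝒰.level b c) le_top (Submonoid.mem_top g) i

/-- Its `U_p`-ordinary part `⋂_{v ∣ p} ⋂ₘ range U_{v,1}^m`. [cite: KhareThorne2017, §2.4] -/
def laOrd (b c s i : ℕ) : Submodule k (𝒰.laCohomology k b c s i) :=
  ⨅ (v : {v : HeightOneSpectrum (𝓞 K) // (p : 𝓞 K) ∈ v.asIdeal}) (m : ℕ),
    LinearMap.range (𝒰.laHecke k b c s (heckeElement 2 K v.1 1) i ^ m)

/-- The comparison `H^i(U(b,c), 1; k/p^s) ≅ H^i(X_{U(b,c)}, k/p^s)` (`LevelActionTrivialOnLevel`).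
[folklore] -/
abbrev laIso (b c s i : ℕ) :
    𝒰.laCohomology k b c s i ≅
      ArithmeticQuotient.cohomology k (globalEmbedding 2 K) (𝒰.level b c) (modPow k (p : k) s) i :=
  cohomologyIso (globalEmbedding 2 K) (⊤ : Submonoid (FiniteAdelicGL 2 K)) (1 : (⊤ : Submonoid (FiniteAdelicGL 2 K)) →* Module.End k (modPow k (p : k) s))
    (𝒰.level b c) le_top (fun _ _ => rfl) i

/-- `laIso` is compatible with every Hecke operator. [folklore] -/
theorem laIso_hom_comp_laHecke (b c s : ℕ) (g : FiniteAdelicGL 2 K) (i : ℕ) :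
    (𝒰.laIso k b c s i).hom.hom ∘ₗ 𝒰.laHecke k b c s g i =
      ArithmeticQuotient.heckeEnd k (𝒰.level b c) g (modPow k (p : k) s) (globalEmbedding 2 K) i ∘ₗ
        (𝒰.laIso k b c s i).hom.hom :=
  heckeCohomology_comp_cohomologyIso_hom_of_eq_one (globalEmbedding 2 K) le_top (fun _ _ => rfl)
    (Submonoid.mem_top g) (fun _ _ _ => rfl) i

/-- **The bridge `H^i(X_{U(r)}, k/p^s) ≅ H^i(U(r, max r 1), 1; k/p^s)`** from the Hida tower factor
to the level-action model. [cite: Hida1994AIF, §1, §3] -/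
def towerBridge (r s i : ℕ) : 𝒰.hidaCohomology k (i, r, s) ≅ 𝒰.laCohomology k r (max r 1) s i :=
  ArithmeticQuotient.levelEqIso k (globalEmbedding 2 K) (modPow k (p : k) s) (𝒰.hidaLevel_eq_level r) i ≪≫
    (𝒰.laIso k r (max r 1) s i).symm

/-- **The bridge carries `[U(r) g U(r)]` to `[U g U]` of the level-action model**, for every `g`.
[folklore] -/
theorem towerBridge_hom_comp_hidaFamily (r s : ℕ) (g : FiniteAdelicGL 2 K) (i : ℕ) :
    (𝒰.towerBridge k r s i).hom.hom ∘ₗ HidaEndFactor.toEnd 𝒰 k (𝒰.hidaFamily k g (i, r, s)) =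
      𝒰.laHecke k r (max r 1) s g i ∘ₗ (𝒰.towerBridge k r s i).hom.hom := by
  have h1 := ArithmeticQuotient.levelEqIso_hom_comp_heckeEnd k (globalEmbedding 2 K) (modPow k (p : k) s)
    (𝒰.hidaLevel_eq_level r) g i
  have h2' := ModuleCat.inv_hom_comp_eq_of_hom_comp _ (𝒰.laIso_hom_comp_laHecke k r (max r 1) s g i)
  rw [towerBridge, Iso.trans_hom, Iso.symm_hom, ModuleCat.hom_comp, LinearMap.comp_assoc]
  change ((𝒰.laIso k r (max r 1) s i).inv.hom ∘ₗ
      (ArithmeticQuotient.levelEqIso k (globalEmbedding 2 K) (modPow k (p : k) s)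
        (𝒰.hidaLevel_eq_level r) i).hom.hom) ∘ₗ
      ArithmeticQuotient.heckeEnd k (𝒰.hidaLevel r) g (modPow k (p : k) s) (globalEmbedding 2 K) i = _
  rw [LinearMap.comp_assoc, h1, ← LinearMap.comp_assoc, h2', LinearMap.comp_assoc]
  rfl

/-! ### Ordinary parts correspond -/

/-- `Φ(range T^m) = range T'^m` for an isomorphism `Φ` with `Φ ∘ T = T' ∘ Φ`. [folklore] -/
theorem map_range_pow_eq_of_comp_eq {X Y : ModuleCat k} (e : X ≅ Y) {T : Module.End k X}
    {T' : Module.End k Y} (h : e.hom.hom ∘ₗ T = T' ∘ₗ e.hom.hom) (m : ℕ) :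
    (LinearMap.range (T ^ m)).map e.hom.hom = LinearMap.range (T' ^ m) := by
  have hsurj : LinearMap.range e.hom.hom = ⊤ := LinearMap.range_eq_top.2 e.toLinearEquiv.surjective
  rw [← LinearMap.range_comp, comp_pow_eq_pow_comp_of_comp_eq h m,
    LinearMap.range_comp_of_range_eq_top _ hsurj]

/-- **The bridge carries `H^i(X_{U(r)}, k/p^s)^{ord}` onto the level-action ordinary part `laOrd`.**
[cite: KhareThorne2017, §2.4, Lemma 2.10] -/
theorem map_ordinaryPart_towerBridge (h𝒰 : 𝒰.IsMaximalAbove) (r s i : ℕ) :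
    (𝒰.ordinaryPart k (i, r, s)).map (𝒰.towerBridge k r s i).hom.hom = 𝒰.laOrd k r (max r 1) s i := by
  rw [ordinaryPart_eq_iInf_range 𝒰 h𝒰 k (i, r, s), laOrd]
  set e := (𝒰.towerBridge k r s i).toLinearEquiv with he
  have hcoe : (𝒰.towerBridge k r s i).hom.hom = (e : _ →ₗ[k] _) := rfl
  rw [hcoe, Submodule.map_equiv_eq_comap_symm, Submodule.comap_iInf]
  letI : Unique (Fin (2 - 1)) := inferInstanceAs (Unique (Fin 1))
  refine iInf_congr fun v => ?_
  rw [Submodule.comap_iInf, iInf_unique, Submodule.comap_iInf]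
  refine iInf_congr fun m => ?_
  rw [← Submodule.map_equiv_eq_comap_symm, ← hcoe]
  change Submodule.map (𝒰.towerBridge k r s i).hom.hom (LinearMap.range
    (HidaEndFactor.toEnd 𝒰 k (𝒰.hidaFamily k (heckeElement 2 K v.1 1) (i, r, s)) ^ m)) =
    LinearMap.range (𝒰.laHecke k r (max r 1) s (heckeElement 2 K v.1 1) i ^ m)
  exact map_range_pow_eq_of_comp_eq k (𝒰.towerBridge k r s i)
    (𝒰.towerBridge_hom_comp_hidaFamily k r s (heckeElement 2 K v.1 1) i) m

/-- Pointwise: `x ∈ H^{ord}` iff `Φ x ∈ laOrd`. [folklore] -/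
theorem mem_ordinaryPart_iff_towerBridge (h𝒰 : 𝒰.IsMaximalAbove) (r s i : ℕ)
    (x : 𝒰.hidaCohomology k (i, r, s)) :
    x ∈ 𝒰.ordinaryPart k (i, r, s) ↔ (𝒰.towerBridge k r s i).hom.hom x ∈ 𝒰.laOrd k r (max r 1) s i := by
  rw [← 𝒰.map_ordinaryPart_towerBridge k h𝒰 r s i]
  constructor
  · exact fun hx => Submodule.mem_map_of_mem hx
  · rintro ⟨y, hy, hxy⟩
    rwa [← (𝒰.towerBridge k r s i).toLinearEquiv.injective hxy]

/-! ### The polynomial Hecke ring acting through `𝕋^S(𝒰; p)` -/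

/-- `𝕋^S(𝒰; p)` as a commutative ring (`GL₂`, `𝒰` maximal above `p`). [cite: Hida1994AIF, §2] -/
instance HidaHeckeAlgebraGLn.instCommRing [h𝒰 : Fact 𝒰.IsMaximalAbove] :
    CommRing (HidaHeckeAlgebraGLn 𝒰) :=
  { (inferInstance : Ring (HidaHeckeAlgebraGLn 𝒰)) with
    mul_comm := HidaHeckeAlgebraGLn.mul_comm_of_isMaximalAbove h𝒰.out }

/-- **`ℤ[T^abs] → 𝕋^S(𝒰; p)`**, `X_g ↦ hidaOp g` (lifting `heckePolyHom` to the Hecke algebra of the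
whole tower, before restriction to the ordinary parts). [cite: KhareThorne2017, §6.5] -/
def hidaPolyHom [Fact 𝒰.IsMaximalAbove] : MvPolynomial 𝒰.hidaElements ℤ →+* HidaHeckeAlgebraGLn 𝒰 :=
  MvPolynomial.eval₂Hom (Int.castRingHom _) fun g => 𝒰.hidaOp g.2

/-- `hidaPolyHom (X_g) = hidaOp g`. [folklore] -/
@[simp]
theorem hidaPolyHom_X [Fact 𝒰.IsMaximalAbove] (g : 𝒰.hidaElements) :
    𝒰.hidaPolyHom (MvPolynomial.X g) = 𝒰.hidaOp g.2 := by
  rw [hidaPolyHom, MvPolynomial.coe_eval₂Hom, MvPolynomial.eval₂_X]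

/-- `toOrd ∘ hidaPolyHom = heckePolyHom`. [folklore] -/
theorem toOrd_comp_hidaPolyHom [Fact 𝒰.IsMaximalAbove] :
    (𝒰.toOrd ℤ).comp 𝒰.hidaPolyHom = 𝒰.heckePolyHom := by
  refine MvPolynomial.ringHom_ext (fun n => by simp) fun g => ?_
  rw [RingHom.comp_apply, hidaPolyHom_X, heckePolyHom_X, toOrd_hidaOp]

/-- **The `ℤ[T^abs]`-action on `H^{ord}_y` is through the operators of `𝕋^S(𝒰; p)` on `H_y`**:
`z • m = (hidaPolyHom z)_y m` in `H^i(X_{U(r)}, ℤ/p^s)`. [folklore] -/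
theorem coe_heckePoly_smul [Fact 𝒰.IsMaximalAbove] (y : TowerIndex) (z : MvPolynomial 𝒰.hidaElements ℤ)
    (m : 𝒰.ordinaryPart ℤ y) :
    ((z • m : 𝒰.ordinaryPart ℤ y) : 𝒰.hidaCohomology ℤ y) =
      ((𝒰.hidaPolyHom z : HidaHeckeAlgebraGLn 𝒰) : 𝒰.hidaEndProd ℤ) y (m : 𝒰.hidaCohomology ℤ y) := by
  rw [heckePoly_smul_def, ← toOrd_comp_hidaPolyHom]
  rfl

/-- **A map commuting with the operators of all Hida elements commutes with `ℤ[T^abs]`**: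
if `Φ ∘ [U g U]_A = [U g U]_B ∘ Φ` for every Hida element `g`, then `Φ ∘ (z)_A = (z)_B ∘ Φ` for every
`z ∈ ℤ[T^abs]`. [folklore] -/
theorem comp_hidaPolyHom_eq [Fact 𝒰.IsMaximalAbove] {A B : TowerIndex}
    (Φ : 𝒰.hidaCohomology ℤ A →ₗ[ℤ] 𝒰.hidaCohomology ℤ B)
    (hΦ : ∀ g ∈ 𝒰.hidaElements, Φ ∘ₗ HidaEndFactor.toEnd 𝒰 ℤ (𝒰.hidaFamily ℤ g A) =
      HidaEndFactor.toEnd 𝒰 ℤ (𝒰.hidaFamily ℤ g B) ∘ₗ Φ)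
    (z : MvPolynomial 𝒰.hidaElements ℤ) :
    Φ ∘ₗ HidaEndFactor.toEnd 𝒰 ℤ (((𝒰.hidaPolyHom z : HidaHeckeAlgebraGLn 𝒰) : 𝒰.hidaEndProd ℤ) A) =
      HidaEndFactor.toEnd 𝒰 ℤ (((𝒰.hidaPolyHom z : HidaHeckeAlgebraGLn 𝒰) : 𝒰.hidaEndProd ℤ) B) ∘ₗ Φ := by
  induction z using MvPolynomial.induction_on with
  | C a =>
    rw [hidaPolyHom, MvPolynomial.coe_eval₂Hom, MvPolynomial.eval₂_C, eq_intCast]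
    refine LinearMap.ext fun m => ?_
    change Φ (((a : HidaHeckeAlgebraGLn 𝒰) : 𝒰.hidaEndProd ℤ) A m) =
      ((a : HidaHeckeAlgebraGLn 𝒰) : 𝒰.hidaEndProd ℤ) B (Φ m)
    rw [Subring.coe_intCast, Pi.intCast_apply, Pi.intCast_apply]
    change Φ ((a : Module.End ℤ (𝒰.hidaCohomology ℤ A)) m) = (a : Module.End ℤ (𝒰.hidaCohomology ℤ B)) (Φ m)
    rw [Module.End.intCast_apply, Module.End.intCast_apply, map_zsmul]
  | add p q hp hq =>
    rw [map_add, Subring.coe_add, Pi.add_apply, Pi.add_apply]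
    refine LinearMap.ext fun m => ?_
    have hpm := LinearMap.congr_fun hp m
    have hqm := LinearMap.congr_fun hq m
    simp only [LinearMap.coe_comp, Function.comp_apply] at hpm hqm ⊢
    change Φ (HidaEndFactor.toEnd 𝒰 ℤ (((𝒰.hidaPolyHom p : HidaHeckeAlgebraGLn 𝒰) : 𝒰.hidaEndProd ℤ) A) m +
        HidaEndFactor.toEnd 𝒰 ℤ (((𝒰.hidaPolyHom q : HidaHeckeAlgebraGLn 𝒰) : 𝒰.hidaEndProd ℤ) A) m) =
      HidaEndFactor.toEnd 𝒰 ℤ (((𝒰.hidaPolyHom p : HidaHeckeAlgebraGLn 𝒰) : 𝒰.hidaEndProd ℤ) B) (Φ m) +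
        HidaEndFactor.toEnd 𝒰 ℤ (((𝒰.hidaPolyHom q : HidaHeckeAlgebraGLn 𝒰) : 𝒰.hidaEndProd ℤ) B) (Φ m)
    rw [map_add, hpm, hqm]
  | mul_X q g hq =>
    rw [map_mul, hidaPolyHom_X, Subring.coe_mul, Pi.mul_apply, Pi.mul_apply]
    refine LinearMap.ext fun m => ?_
    have hqm := LinearMap.congr_fun hq
    have hgm := LinearMap.congr_fun (hΦ g.1 g.2)
    simp only [LinearMap.coe_comp, Function.comp_apply] at hqm hgm ⊢
    change Φ (HidaEndFactor.toEnd 𝒰 ℤ (((𝒰.hidaPolyHom q : HidaHeckeAlgebraGLn 𝒰) : 𝒰.hidaEndProd ℤ) A)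
        (HidaEndFactor.toEnd 𝒰 ℤ (𝒰.hidaFamily ℤ g.1 A) m)) =
      HidaEndFactor.toEnd 𝒰 ℤ (((𝒰.hidaPolyHom q : HidaHeckeAlgebraGLn 𝒰) : 𝒰.hidaEndProd ℤ) B)
        (HidaEndFactor.toEnd 𝒰 ℤ (𝒰.hidaFamily ℤ g.1 B) (Φ m))
    rw [hqm, hgm]

/-! ### Transfer: level-action maps give `ℤ[T^abs]`-statements on the tower factors -/

/-- The `ℤ[T^abs]`-module structure of `HeckePolynomialPoint` at an explicit index `(i, r, s)`
(the same instance; restated so that instance search finds it on explicit triples, whose unfolded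
head differs from that of an abstract index). [folklore] -/
instance moduleOrdinaryPart' [Fact 𝒰.IsMaximalAbove] (i r s : ℕ) :
    Module (MvPolynomial 𝒰.hidaElements ℤ) (𝒰.ordinaryPart ℤ (i, r, s)) :=
  𝒰.moduleOrdinaryPart (i, r, s)

section Transfer

variable [Fact 𝒰.IsMaximalAbove] {i r s i' r' s' : ℕ}
  (Φ : 𝒰.laCohomology ℤ r (max r 1) s i →ₗ[ℤ] 𝒰.laCohomology ℤ r' (max r' 1) s' i')

/-- The map of tower factors `H^i(X_{U(r)}, ℤ/p^s) → H^{i'}(X_{U(r')}, ℤ/p^{s'})` obtained by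
conjugating a map of the level-action model by the bridges. [folklore] -/
def towerConj : 𝒰.hidaCohomology ℤ (i, r, s) →ₗ[ℤ] 𝒰.hidaCohomology ℤ (i', r', s') :=
  (𝒰.towerBridge ℤ r' s' i').inv.hom ∘ₗ Φ ∘ₗ (𝒰.towerBridge ℤ r s i).hom.hom

omit [Fact 𝒰.IsMaximalAbove] in
/-- Unfolding `towerConj`. [folklore] -/
theorem towerConj_apply (x : 𝒰.hidaCohomology ℤ (i, r, s)) :
    𝒰.towerConj Φ x = (𝒰.towerBridge ℤ r' s' i').inv.hom (Φ ((𝒰.towerBridge ℤ r s i).hom.hom x)) :=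
  rfl

omit [Fact 𝒰.IsMaximalAbove] in
/-- `e.hom (e.inv y) = y` for the bridge. [folklore] -/
theorem towerBridge_hom_inv_apply (y : 𝒰.laCohomology ℤ r' (max r' 1) s' i') :
    (𝒰.towerBridge ℤ r' s' i').hom.hom ((𝒰.towerBridge ℤ r' s' i').inv.hom y) = y := by
  change ((𝒰.towerBridge ℤ r' s' i').inv ≫ (𝒰.towerBridge ℤ r' s' i').hom).hom y = y
  rw [Iso.inv_hom_id]
  rfl

omit [Fact 𝒰.IsMaximalAbove] in
/-- **Conjugation transports Hecke-equivariance**: if `Φ` commutes with `[U g U]` of the level-action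
models for every Hida element `g`, then `towerConj Φ` commutes with the tower operators of `g`.
[folklore] -/
theorem towerConj_comp_hidaFamily
    (hLA : ∀ g ∈ 𝒰.hidaElements, Φ ∘ₗ 𝒰.laHecke ℤ r (max r 1) s g i = 𝒰.laHecke ℤ r' (max r' 1) s' g i' ∘ₗ Φ)
    (g : FiniteAdelicGL 2 K) (hg : g ∈ 𝒰.hidaElements) :
    𝒰.towerConj Φ ∘ₗ HidaEndFactor.toEnd 𝒰 ℤ (𝒰.hidaFamily ℤ g (i, r, s)) =
      HidaEndFactor.toEnd 𝒰 ℤ (𝒰.hidaFamily ℤ g (i', r', s')) ∘ₗ 𝒰.towerConj Φ := by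
  have hA := 𝒰.towerBridge_hom_comp_hidaFamily ℤ r s g i
  have hB := ModuleCat.inv_hom_comp_eq_of_hom_comp _ (𝒰.towerBridge_hom_comp_hidaFamily ℤ r' s' g i')
  rw [towerConj, LinearMap.comp_assoc, LinearMap.comp_assoc, hA, ← LinearMap.comp_assoc _ _ Φ,
    hLA g hg, LinearMap.comp_assoc, ← LinearMap.comp_assoc _ _ (𝒰.towerBridge ℤ r' s' i').inv.hom, hB,
    LinearMap.comp_assoc]

/-- Hence it commutes with the whole of `ℤ[T^abs]`. [folklore] -/
theorem towerConj_comp_hidaPolyHom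
    (hLA : ∀ g ∈ 𝒰.hidaElements, Φ ∘ₗ 𝒰.laHecke ℤ r (max r 1) s g i = 𝒰.laHecke ℤ r' (max r' 1) s' g i' ∘ₗ Φ)
    (z : MvPolynomial 𝒰.hidaElements ℤ) :
    𝒰.towerConj Φ ∘ₗ HidaEndFactor.toEnd 𝒰 ℤ (((𝒰.hidaPolyHom z : HidaHeckeAlgebraGLn 𝒰) :
        𝒰.hidaEndProd ℤ) (i, r, s)) =
      HidaEndFactor.toEnd 𝒰 ℤ (((𝒰.hidaPolyHom z : HidaHeckeAlgebraGLn 𝒰) : 𝒰.hidaEndProd ℤ) (i', r', s')) ∘ₗ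
        𝒰.towerConj Φ :=
  𝒰.comp_hidaPolyHom_eq (𝒰.towerConj Φ) (fun g hg => 𝒰.towerConj_comp_hidaFamily Φ hLA g hg) z

omit [Fact 𝒰.IsMaximalAbove] in
/-- A map commuting with the `U_{v,1}` carries `laOrd` into `laOrd`. [folklore] -/
theorem mapsTo_laOrd_of_comm
    (hU : ∀ (v : HeightOneSpectrum (𝓞 K)), (p : 𝓞 K) ∈ v.asIdeal →
      Φ ∘ₗ 𝒰.laHecke ℤ r (max r 1) s (heckeElement 2 K v 1) i =
        𝒰.laHecke ℤ r' (max r' 1) s' (heckeElement 2 K v 1) i' ∘ₗ Φ)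
    {x : 𝒰.laCohomology ℤ r (max r 1) s i} (hx : x ∈ 𝒰.laOrd ℤ r (max r 1) s i) :
    Φ x ∈ 𝒰.laOrd ℤ r' (max r' 1) s' i' := by
  simp only [laOrd, Submodule.mem_iInf] at hx ⊢
  intro v
  exact (Submodule.mem_iInf _).1 (mapsTo_iInf_range_pow_of_comp_eq (hU v.1 v.2)
    ((Submodule.mem_iInf _).2 (hx v)))

/-- **`towerConj Φ` maps `H^{ord}` to `H^{ord}`** when `Φ` maps `laOrd` to `laOrd`. [folklore] -/
theorem towerConj_mem_ordinaryPart (hOrd : ∀ x ∈ 𝒰.laOrd ℤ r (max r 1) s i, Φ x ∈ 𝒰.laOrd ℤ r' (max r' 1) s' i')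
    {x : 𝒰.hidaCohomology ℤ (i, r, s)} (hx : x ∈ 𝒰.ordinaryPart ℤ (i, r, s)) :
    𝒰.towerConj Φ x ∈ 𝒰.ordinaryPart ℤ (i', r', s') := by
  have h𝒰 : 𝒰.IsMaximalAbove := Fact.out
  rw [𝒰.mem_ordinaryPart_iff_towerBridge ℤ h𝒰, towerConj_apply, towerBridge_hom_inv_apply]
  exact hOrd _ ((𝒰.mem_ordinaryPart_iff_towerBridge ℤ h𝒰 r s i x).1 hx)

/-- **Transfer along an injection**: if `Φ` (Hecke-equivariant, `laOrd → laOrd`) is injective on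
`laOrd`, then every `z ∈ ℤ[T^abs]` killing `H^{ord}` at the target index kills `H^{ord}` at the
source index. [cite: Hida1994AIF, §3] -/
theorem forall_smul_eq_zero_of_injOn
    (hLA : ∀ g ∈ 𝒰.hidaElements, Φ ∘ₗ 𝒰.laHecke ℤ r (max r 1) s g i = 𝒰.laHecke ℤ r' (max r' 1) s' g i' ∘ₗ Φ)
    (hOrd : ∀ x ∈ 𝒰.laOrd ℤ r (max r 1) s i, Φ x ∈ 𝒰.laOrd ℤ r' (max r' 1) s' i')
    (hinj : ∀ x ∈ 𝒰.laOrd ℤ r (max r 1) s i, Φ x = 0 → x = 0)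
    (z : MvPolynomial 𝒰.hidaElements ℤ)
    (hz : ∀ m : 𝒰.ordinaryPart ℤ (i', r', s'), z • m = 0) (m : 𝒰.ordinaryPart ℤ (i, r, s)) :
    z • m = 0 := by
  have h𝒰 : 𝒰.IsMaximalAbove := Fact.out
  -- the image of `m` is an ordinary class at the target, killed by `z`
  set m' : 𝒰.ordinaryPart ℤ (i', r', s') := ⟨𝒰.towerConj Φ (m : 𝒰.hidaCohomology ℤ (i, r, s)),
    𝒰.towerConj_mem_ordinaryPart Φ hOrd m.2⟩ with hm'
  have hzm' := congrArg Subtype.val (hz m')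
  rw [coe_heckePoly_smul, ZeroMemClass.coe_zero] at hzm'
  -- so `towerConj Φ (z • m) = 0`
  have hconj : 𝒰.towerConj Φ ((z • m : 𝒰.ordinaryPart ℤ (i, r, s)) : 𝒰.hidaCohomology ℤ (i, r, s)) = 0 := by
    rw [coe_heckePoly_smul]
    have h := LinearMap.congr_fun (𝒰.towerConj_comp_hidaPolyHom Φ hLA z) (m : 𝒰.hidaCohomology ℤ (i, r, s))
    simp only [LinearMap.coe_comp, Function.comp_apply] at h
    change 𝒰.towerConj Φ ((((𝒰.hidaPolyHom z : HidaHeckeAlgebraGLn 𝒰) : 𝒰.hidaEndProd ℤ) (i, r, s))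
      (m : 𝒰.hidaCohomology ℤ (i, r, s))) = 0
    erw [h]
    exact hzm'
  -- hence `z • m = 0` by the injectivity of `Φ` on `laOrd`
  rw [towerConj_apply] at hconj
  have hΦ0 : Φ ((𝒰.towerBridge ℤ r s i).hom.hom
      ((z • m : 𝒰.ordinaryPart ℤ (i, r, s)) : 𝒰.hidaCohomology ℤ (i, r, s))) = 0 := by
    have := congrArg (𝒰.towerBridge ℤ r' s' i').hom.hom hconj
    rwa [towerBridge_hom_inv_apply, map_zero] at this
  have hmem : (𝒰.towerBridge ℤ r s i).hom.hom
      ((z • m : 𝒰.ordinaryPart ℤ (i, r, s)) : 𝒰.hidaCohomology ℤ (i, r, s)) ∈ 𝒰.laOrd ℤ r (max r 1) s i :=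
    (𝒰.mem_ordinaryPart_iff_towerBridge ℤ h𝒰 r s i _).1 (z • m).2
  have h0 := hinj _ hmem hΦ0
  refine Subtype.ext ((𝒰.towerBridge ℤ r s i).toLinearEquiv.injective ?_)
  rw [ZeroMemClass.coe_zero, map_zero]
  exact h0

/-- **Transfer along a map surjective up to `N`**: if every `N • y`, `y ∈ laOrd` at the target, is
`Φ x` for some `x ∈ laOrd` at the source (Hecke-equivariant `Φ`), then for every `z ∈ ℤ[T^abs]` killing
`H^{ord}` at the source, `N z` kills `H^{ord}` at the target. [cite: Hida1994AIF, §3] -/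
theorem forall_nsmul_smul_eq_zero_of_surjOn
    (hLA : ∀ g ∈ 𝒰.hidaElements, Φ ∘ₗ 𝒰.laHecke ℤ r (max r 1) s g i = 𝒰.laHecke ℤ r' (max r' 1) s' g i' ∘ₗ Φ)
    {N : ℕ} (hsurj : ∀ y ∈ 𝒰.laOrd ℤ r' (max r' 1) s' i', ∃ x ∈ 𝒰.laOrd ℤ r (max r 1) s i, Φ x = N • y)
    (z : MvPolynomial 𝒰.hidaElements ℤ)
    (hz : ∀ m : 𝒰.ordinaryPart ℤ (i, r, s), z • m = 0) (m : 𝒰.ordinaryPart ℤ (i', r', s')) :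
    z • (N • m) = 0 := by
  have h𝒰 : 𝒰.IsMaximalAbove := Fact.out
  obtain ⟨x, hx, hΦx⟩ := hsurj _ ((𝒰.mem_ordinaryPart_iff_towerBridge ℤ h𝒰 r' s' i' _).1 m.2)
  -- `x` comes from an ordinary class `m₀` at the source with `towerConj Φ m₀ = N • m`
  set m₀ : 𝒰.ordinaryPart ℤ (i, r, s) := ⟨(𝒰.towerBridge ℤ r s i).inv.hom x, by
    rw [𝒰.mem_ordinaryPart_iff_towerBridge ℤ h𝒰]
    change (((𝒰.towerBridge ℤ r s i).inv ≫ (𝒰.towerBridge ℤ r s i).hom).hom x) ∈ _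
    rwa [Iso.inv_hom_id]⟩ with hm₀
  have hconj : 𝒰.towerConj Φ (m₀ : 𝒰.hidaCohomology ℤ (i, r, s)) =
      ((N • m : 𝒰.ordinaryPart ℤ (i', r', s')) : 𝒰.hidaCohomology ℤ (i', r', s')) := by
    rw [towerConj_apply]
    change (𝒰.towerBridge ℤ r' s' i').inv.hom (Φ ((((𝒰.towerBridge ℤ r s i).inv ≫
      (𝒰.towerBridge ℤ r s i).hom).hom x))) = _
    rw [Iso.inv_hom_id, ModuleCat.hom_id, LinearMap.id_apply, hΦx, map_nsmul]
    have hm : (𝒰.towerBridge ℤ r' s' i').inv.hom ((𝒰.towerBridge ℤ r' s' i').hom.hom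
        (m : 𝒰.hidaCohomology ℤ (i', r', s'))) = (m : 𝒰.hidaCohomology ℤ (i', r', s')) := by
      change (((𝒰.towerBridge ℤ r' s' i').hom ≫ (𝒰.towerBridge ℤ r' s' i').inv).hom
        (m : 𝒰.hidaCohomology ℤ (i', r', s'))) = _
      rw [Iso.hom_inv_id]
      rfl
    rw [hm]
    rfl
  -- apply `z`: `z • (N • m)` is the image of `z • m₀ = 0`
  have hzm₀ := congrArg Subtype.val (hz m₀)
  rw [coe_heckePoly_smul, ZeroMemClass.coe_zero] at hzm₀
  refine Subtype.ext ?_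
  rw [coe_heckePoly_smul, ZeroMemClass.coe_zero, ← hconj]
  have h := LinearMap.congr_fun (𝒰.towerConj_comp_hidaPolyHom Φ hLA z) (m₀ : 𝒰.hidaCohomology ℤ (i, r, s))
  simp only [LinearMap.coe_comp, Function.comp_apply] at h
  change (((𝒰.hidaPolyHom z : HidaHeckeAlgebraGLn 𝒰) : 𝒰.hidaEndProd ℤ) (i', r', s'))
    (𝒰.towerConj Φ (m₀ : 𝒰.hidaCohomology ℤ (i, r, s))) = 0
  erw [← h]
  change 𝒰.towerConj Φ ((((𝒰.hidaPolyHom z : HidaHeckeAlgebraGLn 𝒰) : 𝒰.hidaEndProd ℤ) (i, r, s))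
    (m₀ : 𝒰.hidaCohomology ℤ (i, r, s))) = 0
  rw [hzm₀, map_zero]

end Transfer

end TameLevel

end BigHeckeGLn


end Literature.NumberTheory.Automorphic
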